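import Literature.MathematicalPhysics.QuantumFieldTheory.Balaban1983to89.B15Claim189OmegaPPPin

/-!
# `Balaban1983to89.B15Claim189ChiOmega4Pin` — YM-DAG node N12 · [Balaban1989LargeFieldI] CMP **122** (1989) 175–202, (1.2) p. 178 ∕ (1.76) p. 194 ∕ (1.89) p. 198 with
# [Balaban1988Convergent] (2.17) p. 257: THE CUBE FAMILY OF THE FACTOR `χ_k(Ω_k^{∼4})` OF THE (1.89) SITUATION PINNED — the `LM₂R_k`-cubes of record CONTAINED in `Ω_k^{∼4}` —
# the factor UNFOLDED to [III] (2.17)'s small-field conditions about objects of record, and its JUNCTION with def-R's `χ_k(T_η)` of record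

statement-level bookkeeping over published theorems with citation tags; kernel-checked compositions of tree theorems; nothing here is a claim about the Yang–Mills
mass gap.

CITATION HEADER (lean-in-tree rule).  Sources, verbatim: [Balaban1988Convergent] («[III]») (2.17) p. 257: *"χ_k(Ω_k) = Π_{□⊂Ω_k} χ({sup_{p⊂□^∼}|U_{k,□}(V_k, ∂p) − 1| < ε_kη²}),
(2.17) where the cubes □ belong to the partition of the lattice T_η into cubes of the size LM₂R_k"*; [Balaban1989LargeFieldI] («[IV]») (1.2) p. 178: *"𝐓_k(Z)exp A_k = χ_k(Ω_k^{∼4})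
Π_{j=k−1}^{h} 𝐓^{(j)}(Z_{j+1})χ_h(Ω∖Ω^∼_{h+1})𝐓_h(Z_h)exp A_k, (1.2) where h = k − N, and we have written explicitly the first and the last characteristic functions in the product of the
last N one-step operations"*; (1.76) p. 194: *"χ_k(Ω_k^{∼4})χ_{k,Λ}∫dV_h↾_{Z_h}χ_h(Ω_h∩Z_h)𝐓_h(Z_h)∫dV″↾_{𝔹″_k∩(Λ∩Z^c_h)}χ″_k exp A″_k"*; (1.89) p. 198: *"χ_k(Ω_k^{∼4})χ_{k,Λ}χ_{h,1/2}((Ω″^∼_{h+1})ᶜ∩Ω_h)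
χ′χ_h(Ω_h∩Z_h)χ″_k = χ_k(Ω_k^{∼4})χ_{k,Λ}χ_{h,1/2}((Ω″^∼_{h+1})ᶜ∩Ω_h)χ′"*; p. 179: *"the domains Ω_j^{∼n} are unions of L^{−(k−j)}MR_j-cubes of the lattice T_η"*; p. 178: *"The cubes □
in (1.3) are the LM₂R_j-cubes … or the L^{−(k−j)}LM₂R_j-cubes of the lattice T_η"*.  Seat `pub-ymgap-dag-n12-e` (YM-PLAN Track A, HUMAN RULING D-0062; director-ym R134 row N12 s3),
generation 7, module 18.  BY NAME and UNCHANGED: r11's `B14.Eq216Concrete.chi217 ∕ chi217_eq_one_iff ∕ ukBox` ((2.16)–(2.17) with body), def-R's `Node00.chiOfRecord ∕ cubeSide ∕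
cubeIndices ∕ cubeEnl ∕ plaqInside ∕ bgOfRecord ∕ epsOfRecord` (`SmallFieldChiOfRecord`), `PlaqSmallOn` (`Setup`), p29's `B15Claim189Assembly.Setting189` (the letter `chiΩ4`), module 4's
`Node00.Sit189`, module 11's `omegaOfChain ∕ Sit189.pinTerm`, module 14's `D189OfHist ∕ sitOfHist`, module 16's `enlD ∕ Sit189.pinLambda ∕ claim189_sitOfHist_Λ_of_flow ∕
claim189_sitOfHist₁₃_Λ_of_inInterval`, module 17's `Sit189.pinSides ∕ pinOmegaPP ∕ pinSides_sh_pos`, modules 13∕15 (`pinZpp`, `pinDistAt`, `pinCubes`).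

WHY THIS FILE.  p29's assembly keeps the first factor `χ_k(Ω_k^{∼4})` of the remaining product of (1.89) as an ABSTRACT letter `chiΩ4 : C → Prop` (*«they act only through the leaves»*:
the (1.80) ∕ (1.75) inputs consume its small-field conditions near `Ω_k`).  Module 4 read it at r11's print's-instance `chi217 … XΩ4 … = 1` over a RESIDUAL index family `σ.XΩ4`, and
module 17 pinned the cube side `sk` to def-R's `LM₂R_k`-side `cubeSide L M₂ R_k k` — so its cube GEOMETRY is def-R's `χ_k`-of-record geometry (`plaqT4_enl44_pinSides`).  What was
left: WHICH cubes.  [III] (2.17) reads `χ_k(X)` as the product over the partition cubes `□ ⊂ X`; (1.2)∕(1.76)∕(1.89) take `X = Ω_k^{∼4}` — four layers of `𝐃_k`-cubes around `Ω_k`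
(p. 179), module 16's `enlD 4 k Ω_k`.  THIS FILE pins `XΩ4 :=` the `sk`-cubes of def-R's partition CONTAINED in `Ω_{k′}^{∼4}` and certifies: (a) at the fully pinned stack the factor
`χ_k(Ω_k^{∼4})` of the (1.89) letters UNFOLDS to [III] (2.17)'s conditions *«sup_{p⊂□^∼}|U_{k,□}(V_k, ∂p) − 1| < ε_kη²»* for every `LM₂R_k`-cube of record inside `Ω^{∼4}_{k′}`, at r11's
(2.16) `ukBox` over def-R's solution map of record — the SMALL-FIELD INPUT NEAR `Ω_k` of the future (1.80)∕(1.75) providers, now about objects of record only; (b) THE JUNCTION with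
def-R's `χ_k(T_η)` of record (`chiOfRecord`, the 𝐓-step factor carried by NODE 00's densities and [B16] (0.1)): `χ_k(T_η) = 1 ⟹ χ_k(Ω_k^{∼4}) = 1` (a sub-product of a product of
`0∕1` factors) — so the (1.89) antecedent's first factor is IMPLIED by the record's own small-field factor at the same configuration.

* §1 THE PIN **`Node00.Sit189.pinXΩ4 σ s enl`** (`XΩ4 := {a ∈ cubeIndices sk | □_a ⊆ enl 4 k′ Ω_{k′}}`) + faces (`mem_pinXΩ4_iff`, `pinXΩ4_kept`, `pinXΩ4_comm`); ORDER: after module 17's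
  `pinSides` (reads `sk`), before module 14's `D189OfHist` (reads `XΩ4`); independent of the `Ω″` ∕ `Λ` ∕ `Z″` ∕ distance ∕ cube pins.
* §2 AT THE FULLY PINNED STACK `pinSides → pinXΩ4 → pinOmegaPP → pinLambda → pinDistAt → pinZpp → pinCubes → sitOfHist`: `XΩ4_sk_stack` (`rfl`), ★ `chiΩ4_stack_iff` ((a) above),
  ★ `chiΩ4_stack_of_chiOfRecord_eq_one` ((b) above), `chiΩ4_stack_iff_chiOfRecord_of_univ` (if `Ω^{∼4}_{k′}` exhausts the torus the two factors COINCIDE).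
* §3 THE (1.89) DISPLAY AT THE χ-, Ω″-, SIDE-PINNED STACK: ★★★ `claim189_sitOfHist_ΛΩχ_of_flow` and `claim189_sitOfHist₁₃_ΛΩχ_of_inInterval` — module 16's theorems VERBATIM at
  `σ := ((σ.pinSides ν g (k′−N) k′).pinXΩ4 s enlD).pinOmegaPP s N enlD`.  RESIDUAL letters of the situation after this file: the component union `Z` (term), module 13's interpolated
  `Z″_j`, the `χ_h(Ω_h∩Z_h)` family `XH` (inert for `B15Leaf`, whose `dropped := χ″_k` only), the numbers `β, L₀, δ, B₃, B₅, O(1)`, the deviation letters `devV″, dev97`, the exponent `p₁`.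

LOCATED (nothing asserted): (i) *«□ ⊂ Ω_k»* of (2.17) is read as CONTAINMENT of the partition cube `cubeEnl sk a 0` in the region (r11's reading in `chi217`'s docstring; for a region
that is a union of partition cubes — print's standing convention — «contained» and «meeting» agree); (ii) the `LM₂R_k`-cubes (side `L^{k+1}M₂R_k`) and the `𝐃_k`-cubes of `Ω_k^{∼4}`
(side `L^kMR_k`) are different partitions; their nesting (`LM₂ ∣ M` or conversely) is node00-def's numeric admissibility ([DAGN11A-G2-READING-1-CUBESIDE]) and is NOT used here;
(iii) `χ_k(Ω_k^{∼4})` enters the (1.89) assembly only as a hypothesis inside `new189` — this file changes no obligation of the display, it fixes what the hypothesis SAYS.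

HONEST FRAMING.  Count-neutral: one data transformer + finite set ∕ product algebra; NO estimate of Bałaban's asserted; N12 NOT discharged; one finite four-torus programme at fixed
`ε`, Bałaban AS PRINTED with locators; nothing continuum ∕ ℝ⁴ ∕ OS ∕ mass gap ∕ Clay.  No `sorry`, no `axiom`, no `instance`, no `notation`.
-/

noncomputable section

open scoped BigOperators

namespace Literature.MathematicalPhysics.QuantumFieldTheory.Balaban1983to89

namespace B15Claim189ChiOmega4Pin

open DagBinding T4Continuum Node00
open B14DomainGeom (Pt)
open B8Eq17ClassAkV1 (plaqsOf)
open B14.Eq216Concrete (chi217 chi217_eq_one_iff ukBox)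
open B15Claim189PrintedConditions (omegaOfChain)
open B15Claim189LambdaPin (enlD)
open B15Claim189OmegaPPPin (pinSides_sh_pos)

/-! ## §1. THE PIN: `XΩ4 :=` the `LM₂R_k`-cubes of record contained in `Ω_{k′}^{∼4}` -/

section Pin

variable {F : T4Family} {N : ℕ} [NeZero N]

open Classical in
/-- **THE (1.89) SITUATION WITH THE CUBE FAMILY OF `χ_k(Ω_k^{∼4})` PINNED** ([III] (2.17) *«χ_k(Ω_k) = Π_{□⊂Ω_k} χ(…)»* at `X = Ω_k^{∼4}` of [IV] (1.2)∕(1.76)∕(1.89)): `XΩ4 :=` the indices `a`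
of the `σ.sk`-partition whose cube `□_a` is CONTAINED in `enl 4 k′ Ω_{k′}` (the term's clamped chain `omegaOfChain s` at its top index `k′`; `enl` = module 16's `enlD`, or a letter).
ORDER: after module 17's side pin (reads `sk`), before module 14's `D189OfHist` (reads `XΩ4`).  Data, no law. [cite: Balaban1988Convergent, (2.17) p.257; Balaban1989LargeFieldI, (1.2) p.178, (1.89) p.198, p.179] -/
def _root_.Literature.MathematicalPhysics.QuantumFieldTheory.Balaban1983to89.Node00.Sit189.pinXΩ4 {K : ℕ} (σ : Sit189 F N K)
    {D : ℕ → Set (Set (Site (F.P K) 0))} {k' : ℕ} (s : B14.Eq218Concrete.Seq D k') (enl : ℕ → ℕ → Set (Site (F.P K) 0) → Set (Site (F.P K) 0)) : Sit189 F N K :=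
  { σ with XΩ4 := (cubeIndices (F.P K) σ.sk).filter fun a => cubeEnl (F.P K) σ.sk a 0 ⊆ enl 4 k' (omegaOfChain s k') }

variable {K : ℕ} (σ : Sit189 F N K) {D : ℕ → Set (Set (Site (F.P K) 0))} {k' : ℕ} (s : B14.Eq218Concrete.Seq D k')
  (enl : ℕ → ℕ → Set (Site (F.P K) 0) → Set (Site (F.P K) 0))

/-- Membership in the pinned family: a partition index whose cube lies inside `Ω_{k′}^{∼4}`. [cite: Balaban1988Convergent, (2.17) p.257; Balaban1989LargeFieldI, (1.2) p.178] -/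
theorem mem_pinXΩ4_iff (a : Pt (F.P K).d) :
    a ∈ (σ.pinXΩ4 s enl).XΩ4 ↔ a ∈ cubeIndices (F.P K) σ.sk ∧ cubeEnl (F.P K) σ.sk a 0 ⊆ enl 4 k' (omegaOfChain s k') := by
  classical
  show a ∈ (cubeIndices (F.P K) σ.sk).filter (fun a => cubeEnl (F.P K) σ.sk a 0 ⊆ enl 4 k' (omegaOfChain s k')) ↔ _
  rw [Finset.mem_filter]

/-- The pinned family is a SUB-family of def-R's partition indices. [cite: Balaban1988Convergent, (2.17) p.257 (bookkeeping)] -/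
theorem pinXΩ4_subset : (σ.pinXΩ4 s enl).XΩ4 ⊆ cubeIndices (F.P K) σ.sk := fun a ha => ((mem_pinXΩ4_iff σ s enl a).1 ha).1

/-- The pin keeps every other field (`rfl`; `HEq` for the chart letter). [cite: Balaban1989LargeFieldI, (1.89) p.198 (bookkeeping)] -/
theorem pinXΩ4_kept : (σ.pinXΩ4 s enl).𝔤 = σ.𝔤 ∧ HEq (σ.pinXΩ4 s enl).chiP σ.chiP ∧ (σ.pinXΩ4 s enl).h = σ.h ∧ (σ.pinXΩ4 s enl).k₀ = σ.k₀ ∧ (σ.pinXΩ4 s enl).k = σ.k ∧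
    (σ.pinXΩ4 s enl).sh = σ.sh ∧ (σ.pinXΩ4 s enl).sk = σ.sk ∧ (σ.pinXΩ4 s enl).Ω = σ.Ω ∧ (σ.pinXΩ4 s enl).Zpp = σ.Zpp ∧ (σ.pinXΩ4 s enl).Z = σ.Z ∧ (σ.pinXΩ4 s enl).Λ = σ.Λ ∧
    (σ.pinXΩ4 s enl).OmT = σ.OmT ∧ (σ.pinXΩ4 s enl).ΩppT2 = σ.ΩppT2 ∧ (σ.pinXΩ4 s enl).β = σ.β ∧ (σ.pinXΩ4 s enl).L₀ = σ.L₀ ∧ (σ.pinXΩ4 s enl).α = σ.α ∧ (σ.pinXΩ4 s enl).δ = σ.δ ∧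
    (σ.pinXΩ4 s enl).B₃ = σ.B₃ ∧ (σ.pinXΩ4 s enl).B₅ = σ.B₅ ∧ (σ.pinXΩ4 s enl).M = σ.M ∧ (σ.pinXΩ4 s enl).O1 = σ.O1 ∧ (σ.pinXΩ4 s enl).dist = σ.dist ∧
    (σ.pinXΩ4 s enl).Xhalf = σ.Xhalf ∧ (σ.pinXΩ4 s enl).XH = σ.XH ∧ (σ.pinXΩ4 s enl).boxOf = σ.boxOf ∧ (σ.pinXΩ4 s enl).dev0 = σ.dev0 ∧ (σ.pinXΩ4 s enl).devV'' = σ.devV'' ∧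
    (σ.pinXΩ4 s enl).dev97 = σ.dev97 :=
  ⟨rfl, HEq.rfl, rfl, rfl, rfl, rfl, rfl, rfl, rfl, rfl, rfl, rfl, rfl, rfl, rfl, rfl, rfl, rfl, rfl, rfl, rfl, rfl, rfl, rfl, rfl, rfl, rfl, rfl⟩

/-- The `χ_k(Ω_k^{∼4})`-pin commutes with the `Ω″`, term, levels, `Λ`, `Z″`, distance and cube pins (`rfl`: disjoint fields) — NOT with module 17's side pin, which it READS.
[cite: Balaban1989LargeFieldI, (1.89) p.198 (bookkeeping)] -/
theorem pinXΩ4_comm (Nm M Nm' N₀ N₀' Nm'' kd : ℕ) (S : Set (Site (F.P K) 0)) (enl' : ℕ → ℕ → Set (Site (F.P K) 0) → Set (Site (F.P K) 0)) :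
    (σ.pinXΩ4 s enl).pinOmegaPP s Nm enl' = (σ.pinOmegaPP s Nm enl').pinXΩ4 s enl ∧ (σ.pinXΩ4 s enl).pinTerm s = (σ.pinTerm s).pinXΩ4 s enl ∧
    (σ.pinXΩ4 s enl).pinLevels M Nm' N₀ = (σ.pinLevels M Nm' N₀).pinXΩ4 s enl ∧ (σ.pinXΩ4 s enl).pinLambda s N₀' enl' = (σ.pinLambda s N₀' enl').pinXΩ4 s enl ∧
    (σ.pinXΩ4 s enl).pinZpp s N₀' Nm'' enl' = (σ.pinZpp s N₀' Nm'' enl').pinXΩ4 s enl ∧ (σ.pinXΩ4 s enl).pinDistAt kd = (σ.pinDistAt kd).pinXΩ4 s enl ∧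
    (σ.pinXΩ4 s enl).pinCubes S = (σ.pinCubes S).pinXΩ4 s enl :=
  ⟨rfl, rfl, rfl, rfl, rfl, rfl, rfl⟩

/-- After module 17's side pin, the pinned family consists of def-R's `LM₂R_{k′}`-cubes of record (`cubeSide L M₂ R_{k′} k′`) contained in `Ω_{k′}^{∼4}`.
[cite: Balaban1988Convergent, (2.17) p.257; Balaban1989LargeFieldI, p.178] -/
theorem mem_pinXΩ4_pinSides_iff (ν : Stage7Numerics) (g : ℕ → ℝ) (h : ℕ) (a : Pt (F.P K).d) :
    a ∈ ((σ.pinSides ν g h k').pinXΩ4 s enl).XΩ4 ↔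
      a ∈ cubeIndices (F.P K) (cubeSide (F.P K).L ν.M₂ (RkOfRecord (F.P K).L ν.r (g k')) k') ∧
        cubeEnl (F.P K) (cubeSide (F.P K).L ν.M₂ (RkOfRecord (F.P K).L ν.r (g k')) k') a 0 ⊆ enl 4 k' (omegaOfChain s k') :=
  mem_pinXΩ4_iff (σ.pinSides ν g h k') s enl a

end Pin

/-! ## §2. At the fully pinned stack: `χ_k(Ω_k^{∼4})` UNFOLDED to [III] (2.17)'s conditions about objects of record, and its junction with def-R's `χ_k(T_η)` -/

section Stack

open B15Claim189Assembly (Setting189)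
open B15Claim189PinsOfHistory (D189OfHist sitOfHist)
open B15DeterminingSets (MSField)

variable {F : T4Family} {N : ℕ} [NeZero N] {ν : Stage7Numerics} {A₁ : ℝ} {M : ℕ} (Nm : ℕ) (P : B12.RunParams) (σ : Sit189 F N P.K) {g : ℕ → ℝ} {k' : ℕ}
  (s : SeqOfRecord F ν M g P.K k') (N₀ p₁ kd : ℕ) (S : Set (Site (F.P P.K) 0)) (enl enl' enl'' : ℕ → ℕ → Set (Site (F.P P.K) 0) → Set (Site (F.P P.K) 0))

/-- Through the whole stack above the side and `χ`-pins the family `XΩ4` and the side `sk` are the pinned ones (`rfl` ×2). [cite: Balaban1988Convergent, (2.17) p.257 (bookkeeping)] -/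
theorem XΩ4_sk_stack :
    (((((((σ.pinSides ν g (k' - Nm) k').pinXΩ4 s enl).pinOmegaPP s Nm enl').pinLambda s N₀ enl'').pinDistAt kd).pinZpp s N₀ Nm enl'').pinCubes S).XΩ4 =
        ((σ.pinSides ν g (k' - Nm) k').pinXΩ4 s enl).XΩ4 ∧
    (((((((σ.pinSides ν g (k' - Nm) k').pinXΩ4 s enl).pinOmegaPP s Nm enl').pinLambda s N₀ enl'').pinDistAt kd).pinZpp s N₀ Nm enl'').pinCubes S).sk =
        cubeSide (F.P P.K).L ν.M₂ (RkOfRecord (F.P P.K).L ν.r (g k')) k' := ⟨rfl, rfl⟩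

/-- ★ **`χ_k(Ω_k^{∼4})` OF THE (1.89) LETTERS, UNFOLDED, AT OBJECTS OF RECORD**: at the letters `D` of the fully pinned stack (sides, `χ`-family, `Ω″`, `Λ`, distance, `Z″`, cubes, then the
term ∕ levels ∕ χ′ ∕ `dev0` pins of `sitOfHist`), for every configuration `U = (V, B′)`: `χ_k(Ω_k^{∼4})(U)` holds IFF for every `LM₂R_{k′}`-cube `□_a` of def-R's partition with `□_a ⊆ Ω^{∼4}_{k′}`,
[III] (2.17)'s condition `|U_{k′,□}(V_{k′}, ∂p) − 1| < ε_{k′}η²` holds for all `p ⊂ □_a^∼` at r11's (2.16) minimiser `ukBox` over def-R's solution map of record on `□_a^{∼4}` — THE small-field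
input near `Ω_k` that the (1.80) ∕ (1.75) providers consume. [cite: Balaban1988Convergent, (2.16)–(2.17) p.257; Balaban1989LargeFieldI, (1.2) p.178, (1.89) p.198, (1.80) p.195] -/
theorem chiΩ4_stack_iff
    {D' : Setting189 (F.P P.K) (SU N) (MSField (F.P P.K) (SU N) × ((j : ℕ) → VecField (F.P P.K) j (EuclideanSpace ℝ (Fin (N ^ 2 - 1))))) (Pt (F.P P.K).d)}
    (hD : D' = D189OfHist ν P (sitOfHist ν A₁ M Nm P
      (((((((σ.pinSides ν g (k' - Nm) k').pinXΩ4 s enl).pinOmegaPP s Nm enl').pinLambda s N₀ enl'').pinDistAt kd).pinZpp s N₀ Nm enl'').pinCubes S) g s N₀ p₁) g)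
    (U : MSField (F.P P.K) (SU N) × ((j : ℕ) → VecField (F.P P.K) j (EuclideanSpace ℝ (Fin (N ^ 2 - 1))))) :
    D'.chiΩ4 U ↔
      ∀ a ∈ cubeIndices (F.P P.K) (cubeSide (F.P P.K).L ν.M₂ (RkOfRecord (F.P P.K).L ν.r (g k')) k'),
        cubeEnl (F.P P.K) (cubeSide (F.P P.K).L ν.M₂ (RkOfRecord (F.P P.K).L ν.r (g k')) k') a 0 ⊆ enl 4 k' (omegaOfChain s k') →
          PlaqSmallOn (plaqInside (cubeEnl (F.P P.K) (cubeSide (F.P P.K).L ν.M₂ (RkOfRecord (F.P P.K).L ν.r (g k')) k') a 1))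
            (epsOfRecord ν g k' * (F.P P.K).eta k' ^ 2)
            (ukBox (bgOfRecord (avOfRecord F N P.K) {U | PlaqSmall (ν.εreg * (F.P P.K).eta k' ^ 2) U}) ν.M₁
              (cubeEnl (F.P P.K) (cubeSide (F.P P.K).L ν.M₂ (RkOfRecord (F.P P.K).L ν.r (g k')) k') a 4) k' (U.1 k')) := by
  subst hD
  refine (chi217_eq_one_iff (bgOfRecord (avOfRecord F N P.K) {U | PlaqSmall (ν.εreg * (F.P P.K).eta k' ^ 2) U}) ν.M₁
    ((σ.pinSides ν g (k' - Nm) k').pinXΩ4 s enl).XΩ4 _ _ (epsOfRecord ν g k') k' (U.1 k')).trans ?_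
  constructor
  · intro h a ha hsub
    exact h a ((mem_pinXΩ4_pinSides_iff σ s enl ν g (k' - Nm) a).2 ⟨ha, hsub⟩)
  · intro h a ha
    obtain ⟨ha', hsub⟩ := (mem_pinXΩ4_pinSides_iff σ s enl ν g (k' - Nm) a).1 ha
    exact h a ha' hsub

/-- ★ **THE JUNCTION WITH def-R's `χ_k(T_η)` OF RECORD**: if the record's own small-field factor `χ_{k′}(T_η)` (def-R's `chiOfRecord`, the product (2.17) over ALL `LM₂R_{k′}`-cubes at the
record's `ukBox ∘ bgOfRecord`, threshold `ε_{k′}` — the 𝐓-step factor carried by NODE 00's densities) equals `1` at `V_{k′}`, then the (1.89) situation's `χ_k(Ω_k^{∼4})` holds at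
`(V, B′)`: a product of `0∕1` factors over all cubes is `1` only if every factor is, in particular those of the cubes inside `Ω^{∼4}_{k′}`.
[cite: Balaban1988Convergent, (2.17) p.257; Balaban1989LargeFieldI, (1.2) p.178, (1.89) p.198] -/
theorem chiΩ4_stack_of_chiOfRecord_eq_one
    {D' : Setting189 (F.P P.K) (SU N) (MSField (F.P P.K) (SU N) × ((j : ℕ) → VecField (F.P P.K) j (EuclideanSpace ℝ (Fin (N ^ 2 - 1))))) (Pt (F.P P.K).d)}
    (hD : D' = D189OfHist ν P (sitOfHist ν A₁ M Nm P
      (((((((σ.pinSides ν g (k' - Nm) k').pinXΩ4 s enl).pinOmegaPP s Nm enl').pinLambda s N₀ enl'').pinDistAt kd).pinZpp s N₀ Nm enl'').pinCubes S) g s N₀ p₁) g)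
    (U : MSField (F.P P.K) (SU N) × ((j : ℕ) → VecField (F.P P.K) j (EuclideanSpace ℝ (Fin (N ^ 2 - 1)))))
    (hχ : chiOfRecord F N ν g P.K k' (U.1 k') = 1) : D'.chiΩ4 U := by
  rw [chiΩ4_stack_iff Nm P σ s N₀ p₁ kd S enl enl' enl'' hD]
  rw [chiOfRecord_eq_chi217, chi217_eq_one_iff] at hχ
  exact fun a ha _ => hχ a ha

/-- **… AND THE TWO FACTORS COINCIDE WHEN `Ω^{∼4}_{k′}` EXHAUSTS THE TORUS** (e.g. `Ω_{k′} = T_η`, the pure small-field history): then every partition cube lies inside it and the situation's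
`χ_k(Ω_k^{∼4})` IS def-R's `χ_{k′}(T_η) = 1`. [cite: Balaban1988Convergent, (2.17) p.257; Balaban1989LargeFieldI, (1.2) p.178] -/
theorem chiΩ4_stack_iff_chiOfRecord_of_univ
    {D' : Setting189 (F.P P.K) (SU N) (MSField (F.P P.K) (SU N) × ((j : ℕ) → VecField (F.P P.K) j (EuclideanSpace ℝ (Fin (N ^ 2 - 1))))) (Pt (F.P P.K).d)}
    (hD : D' = D189OfHist ν P (sitOfHist ν A₁ M Nm P
      (((((((σ.pinSides ν g (k' - Nm) k').pinXΩ4 s enl).pinOmegaPP s Nm enl').pinLambda s N₀ enl'').pinDistAt kd).pinZpp s N₀ Nm enl'').pinCubes S) g s N₀ p₁) g)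
    (huniv : enl 4 k' (omegaOfChain s k') = Set.univ)
    (U : MSField (F.P P.K) (SU N) × ((j : ℕ) → VecField (F.P P.K) j (EuclideanSpace ℝ (Fin (N ^ 2 - 1))))) :
    D'.chiΩ4 U ↔ chiOfRecord F N ν g P.K k' (U.1 k') = 1 := by
  rw [chiΩ4_stack_iff Nm P σ s N₀ p₁ kd S enl enl' enl'' hD, chiOfRecord_eq_chi217, chi217_eq_one_iff]
  constructor
  · intro h a ha
    exact h a ha (by rw [huniv]; exact Set.subset_univ _)
  · intro h a ha _
    exact h a ha

end Stack

/-! ## §3. THE (1.89) DISPLAY AT THE χ-, Ω″- AND SIDE-PINNED STACK — module 16's theorems, the antecedent's `χ_k(Ω_k^{∼4})` now about objects of record -/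

section Display

open B15 (Ineq180)
open B15.BasicStep (Claim189)
open B15.PrelimIntegrations (Ineq191 Ineq195)
open B15Chi124DetSets (E124)
open B15DeterminingSets (MSField)
open B15Claim189Assembly (Setting189 new189 chiPP dom half)
open B15Claim189PinsOfHistory (D189OfHist sitOfHist N0OfRecord₁₃)
open B15Claim189N0OfRecord (N0OfSeq)
open B15Claim189LambdaPin (claim189_sitOfHist_Λ_of_flow claim189_sitOfHist₁₃_Λ_of_inInterval)
open GaugeGroup (dist1)
open GaugeField (plaqHol)
open FlowStep (HBeta prefixOf BetaUpperH)
open FlowStepRuns (genSeq)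
open B14FlowStep (SmallnessFor)

variable {F : T4Family} {N : ℕ} [NeZero N] {ν : Stage7Numerics} {A₁ : ℝ} {M : ℕ} (Nm : ℕ) (P : B12.RunParams) (σ : Sit189 F N P.K) {g : ℕ → ℝ} {k' : ℕ}
  (s : SeqOfRecord F ν M g P.K k') (p₁ : ℕ)

/-- ★★★ **(1.89) AT THE TERM'S FULLY PINNED STACK WITH THE `χ_k(Ω_k^{∼4})` CUBE FAMILY PINNED TOO** — module 16's `claim189_sitOfHist_Λ_of_flow` VERBATIM at
`σ := ((σ.pinSides ν g (k′−N) k′).pinXΩ4 s enlD).pinOmegaPP s N enlD` (window-free; `N₀ := N0OfSeq L r g k′`).  The antecedent `new189 D U` now reads, besides `χ_{k,Λ}`, `χ_{h,1/2}` and `χ′`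
about objects of record (modules 4, 15–17), `χ_k(Ω_k^{∼4})` about objects of record (§2).  DISPLAYED inputs unchanged from module 17: levels, residual numerics ∕ signs, `0 < M₂`, `0 < M`,
print's two p. 200 conditions, the flow inputs, one step of monotone couplings, `Λ ≠ ∅`, the four ℍ-leaves and (1.80).
[cite: Balaban1989LargeFieldI, (1.89) p.198, (1.2) p.178, p.195, (1.73) p.192, pp.199–200; Balaban1988Convergent, (2.1) p.254, (2.5)–(2.8) pp.255–256, (2.17) p.257] -/
theorem claim189_sitOfHist_ΛΩχ_of_flow (hM₂ : 0 < ν.M₂) (hM : 0 < M)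
    {D : Setting189 (F.P P.K) (SU N) (MSField (F.P P.K) (SU N) × ((j : ℕ) → VecField (F.P P.K) j (EuclideanSpace ℝ (Fin (N ^ 2 - 1))))) (Pt (F.P P.K).d)}
    (hD : D = D189OfHist ν P (sitOfHist ν A₁ M Nm P
      (((((((σ.pinSides ν g (k' - Nm) k').pinXΩ4 s (enlD F ν M P g)).pinOmegaPP s Nm (enlD F ν M P g)).pinLambda s (N0OfSeq (F.P P.K).L ν.r g k') (enlD F ν M P g)).pinDistAt k').pinZpp s (N0OfSeq (F.P P.K).L ν.r g k') Nm (enlD F ν M P g)).pinCubes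
        (((((((σ.pinSides ν g (k' - Nm) k').pinXΩ4 s (enlD F ν M P g)).pinOmegaPP s Nm (enlD F ν M P g)).pinLambda s (N0OfSeq (F.P P.K).L ν.r g k') (enlD F ν M P g)).pinDistAt k').pinZpp s (N0OfSeq (F.P P.K).L ν.r g k') Nm (enlD F ν M P g)).OmTᶜ ∩
          omegaOfChain s (k' - Nm))) g s (N0OfSeq (F.P P.K).L ν.r g k') p₁) g)
    (hlog : 1 < (Real.log (g k' ^ 2)⁻¹) ^ ν.r) (hNN : N0OfSeq (F.P P.K).L ν.r g k' ≤ Nm) (hNk : N0OfSeq (F.P P.K).L ν.r g k' ≤ k')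
    (hβ0 : 0 ≤ σ.β) (hβ : σ.β ≤ 1 / 4) (hL₀ : 2 ≤ σ.L₀) (hL₀L : σ.L₀ ^ 2 ≤ ((F.P P.K).L : ℝ))
    (hB : 0 ≤ σ.O1 * σ.B₃ * σ.B₅) (hδ : 0 ≤ σ.δ)
    (hN₀ : (2 + (121 / 120) ^ 2 * (σ.O1 * σ.B₃ * σ.B₅ * (M : ℝ) ^ 5)) * ((σ.L₀ ^ 2) ^ (N0OfSeq (F.P P.K).L ν.r g k' - 1))⁻¹ ≤ 1 / 4)
    (hMl : (121 / 120) ^ 2 * (σ.O1 * σ.B₃ * σ.B₅ * (M : ℝ) ^ 5) * Real.exp (-(4 * σ.δ * (M : ℝ))) ≤ 1 / 12)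
    (hε0 : ∀ i, k' - Nm ≤ i → i ≤ k' → 0 ≤ epsOfRecord ν g i) (hε1 : ∀ i, k' - Nm ≤ i → i ≤ k' → epsOfRecord ν g i ≤ 1 / 10)
    {β₀ : ℝ} (hβ₀0 : 0 ≤ β₀) (hβ₀ : β₀ ≤ 1 / 2)
    (hflow : ∀ j, k' - Nm ≤ j → j < k' → epsOfRecord ν g k' ≤ (1 + β₀) * Real.sqrt ((k' - j : ℕ) : ℝ) * epsOfRecord ν g j)
    (hgpos : 0 < g (k' + 1 - N0OfSeq (F.P P.K).L ν.r g k')) (hgstep : g (k' + 1 - N0OfSeq (F.P P.K).L ν.r g k') ≤ g (k' + 2 - N0OfSeq (F.P P.K).L ν.r g k'))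
    (hgle : g (k' + 2 - N0OfSeq (F.P P.K).L ν.r g k') ≤ 1)
    (hΛ : ((enlD F ν M P g 4 (k' + 1 - N0OfSeq (F.P P.K).L ν.r g k') (omegaOfChain s (k' + 1 - N0OfSeq (F.P P.K).L ν.r g k')))ᶜ ∩ σ.Z).Nonempty)
    (L91h : ∀ U, new189 D U → ∀ p ∈ plaqsOf (half D),
      Ineq191 (dist1 (plaqHol (D.Upp U) p)) (D.devV'' U p) D.α ((D.L ^ D.h)⁻¹) (D.ε D.h) (E124 D.ε D.L D.η D.k D.h))
    (L95 : ∀ U, new189 D U → ∀ p ∈ plaqsOf (half D),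
      Ineq195 (D.devV'' U p) (dist1 (plaqHol (D.Uhalf U (D.boxOf p)) p)) D.α ((D.L ^ D.h)⁻¹) (D.ε D.h) (E124 D.ε D.L D.η D.k D.h))
    (L91 : ∀ U, new189 D U → ∀ j, D.h ≤ j → j ≤ D.k → ∀ p ∈ plaqsOf (dom D j),
      Ineq191 (dist1 (plaqHol (D.Upp U) p)) (D.dev97 U p) D.α ((D.L ^ j)⁻¹) (D.ε j) (E124 D.ε D.L D.η D.k j))
    (L97 : ∀ U, new189 D U → ∀ j, D.h ≤ j → j ≤ D.k → ∀ p ∈ plaqsOf (dom D j),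
      Ineq191 (D.dev97 U p) (D.dev0 U p) D.α ((D.L ^ j)⁻¹) (D.ε j) (E124 D.ε D.L D.η D.k j))
    (L80 : ∀ U, new189 D U → ∀ j, D.h ≤ j → j ≤ D.k → ∀ p ∈ plaqsOf (dom D j),
      Ineq180 (D.dev0 U p) (D.ε D.k) D.η D.B₃ D.B₅ D.M D.δ (D.dist p) D.O1) :
    Claim189 (new189 D) (chiPP D) :=
  claim189_sitOfHist_Λ_of_flow Nm P (((σ.pinSides ν g (k' - Nm) k').pinXΩ4 s (enlD F ν M P g)).pinOmegaPP s Nm (enlD F ν M P g)) s p₁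
    (pinSides_sh_pos σ ν g (k' - Nm) k' hM₂).1 hM hD hlog hNN hNk hβ0 hβ hL₀ hL₀L hB hδ hN₀ hMl hε0 hε1 hβ₀0 hβ₀ hflow hgpos hgstep hgle hΛ L91h L95 L91 L97 L80

variable {θ : Stage13Params F N} (s₁₃ : SeqOfRecord F θ.ν θ.τ9.M (gOfRecord₁₃ F N θ P) P.K k')

/-- ★★★ **THE SAME AT RECORD 13, IN THE RUN'S (2.7)-SMALL WINDOW** — module 16's `claim189_sitOfHist₁₃_Λ_of_inInterval` VERBATIM at `σ := ((σ.pinSides θ.ν (gOfRecord₁₃ θ P) (k′−N) k′).pinXΩ4 s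
enlD).pinOmegaPP s N enlD` (`N₀ := N0OfRecord₁₃ θ P k′`).  DISPLAYED: memory `N ≥ N₀(P)`, `N₀(P) ≤ k′`, residual numerics ∕ signs, `0 < M₂`, `0 < M`, print's second condition, the window
(`S`, `hI`, `hup`, `hε10`, `hA₀`, `r ≥ 1`, one threshold `hwin`, `β₁₃ ≥ 0`), `Λ ≠ ∅`, the four ℍ-leaves and (1.80).
[cite: Balaban1989LargeFieldI, (1.89) p.198, (1.2) p.178, p.195, (1.73) p.192, pp.199–200; Balaban1988Convergent, (2.1) p.254, (2.4)–(2.8) pp.255–256, (2.17) p.257; Balaban1987RG1, (0.20) p.256, §1 p.264] -/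
theorem claim189_sitOfHist₁₃_ΛΩχ_of_inInterval (hM₂ : 0 < θ.ν.M₂) (hM : 0 < θ.τ9.M)
    {D : Setting189 (F.P P.K) (SU N) (MSField (F.P P.K) (SU N) × ((j : ℕ) → VecField (F.P P.K) j (EuclideanSpace ℝ (Fin (N ^ 2 - 1))))) (Pt (F.P P.K).d)}
    (hD : D = D189OfHist θ.ν P (sitOfHist θ.ν θ.A₁ θ.τ9.M Nm P
      (((((((σ.pinSides θ.ν (gOfRecord₁₃ F N θ P) (k' - Nm) k').pinXΩ4 s₁₃ (enlD F θ.ν θ.τ9.M P (gOfRecord₁₃ F N θ P))).pinOmegaPP s₁₃ Nm (enlD F θ.ν θ.τ9.M P (gOfRecord₁₃ F N θ P))).pinLambda s₁₃ (N0OfRecord₁₃ θ P k') (enlD F θ.ν θ.τ9.M P (gOfRecord₁₃ F N θ P))).pinDistAt k').pinZpp s₁₃ (N0OfRecord₁₃ θ P k') Nm (enlD F θ.ν θ.τ9.M P (gOfRecord₁₃ F N θ P))).pinCubes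
        (((((((σ.pinSides θ.ν (gOfRecord₁₃ F N θ P) (k' - Nm) k').pinXΩ4 s₁₃ (enlD F θ.ν θ.τ9.M P (gOfRecord₁₃ F N θ P))).pinOmegaPP s₁₃ Nm (enlD F θ.ν θ.τ9.M P (gOfRecord₁₃ F N θ P))).pinLambda s₁₃ (N0OfRecord₁₃ θ P k') (enlD F θ.ν θ.τ9.M P (gOfRecord₁₃ F N θ P))).pinDistAt k').pinZpp s₁₃ (N0OfRecord₁₃ θ P k') Nm (enlD F θ.ν θ.τ9.M P (gOfRecord₁₃ F N θ P))).OmTᶜ ∩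
          omegaOfChain s₁₃ (k' - Nm))) (gOfRecord₁₃ F N θ P) s₁₃ (N0OfRecord₁₃ θ P k') p₁) (gOfRecord₁₃ F N θ P))
    (hr : 1 ≤ θ.ν.r) (hNN : (N0OfRecord₁₃ θ P k') ≤ Nm) (hNk : (N0OfRecord₁₃ θ P k') ≤ k')
    (hβ0 : 0 ≤ σ.β) (hβ : σ.β ≤ 1 / 4) (hL₀ : 2 ≤ σ.L₀) (hL₀L : σ.L₀ ^ 2 ≤ ((F.P P.K).L : ℝ))
    (hB : 0 ≤ σ.O1 * σ.B₃ * σ.B₅) (hδ : 0 ≤ σ.δ)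
    (hwin : 4 * (2 + (121 / 120) ^ 2 * (σ.O1 * σ.B₃ * σ.B₅ * (θ.τ9.M : ℝ) ^ 5))
      ≤ ((Real.log ((gOfRecord₁₃ F N θ P) k' ^ 2)⁻¹) ^ θ.ν.r) ^ (Real.log (σ.L₀ ^ 2) / Real.log ((F.P P.K).L : ℝ)))
    (hβhist : ∀ j, j < k' → 0 ≤ betaOfRecord₁₃ F N θ j (prefixOf (gOfRecord₁₃ F N θ P) j))
    (hMl : (121 / 120) ^ 2 * (σ.O1 * σ.B₃ * σ.B₅ * (θ.τ9.M : ℝ) ^ 5) * Real.exp (-(4 * σ.δ * (θ.τ9.M : ℝ))) ≤ 1 / 12)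
    (hA₀ : 0 ≤ θ.ν.A₀) {β' β₀ : ℝ} {L : ℕ} (S : SmallnessFor θ.γ β' β₀ L θ.ν.p₀) (hβ₀ : β₀ ≤ 1 / 2) (hε10 : θ.γ * p0Profile θ.ν.A₀ θ.ν.p₀ θ.γ ≤ 1 / 10)
    (hI : Step.InInterval θ.γ k' (gOfRecord₁₃ F N θ P)) (hup : BetaUpperH β' θ.γ (betaOfRecord₁₃ F N θ))
    (hΛ : (((enlD F θ.ν θ.τ9.M P (gOfRecord₁₃ F N θ P)) 4 (k' + 1 - (N0OfRecord₁₃ θ P k')) (omegaOfChain s₁₃ (k' + 1 - (N0OfRecord₁₃ θ P k'))))ᶜ ∩ σ.Z).Nonempty)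
    (L91h : ∀ U, new189 D U → ∀ p ∈ plaqsOf (half D),
      Ineq191 (dist1 (plaqHol (D.Upp U) p)) (D.devV'' U p) D.α ((D.L ^ D.h)⁻¹) (D.ε D.h) (E124 D.ε D.L D.η D.k D.h))
    (L95 : ∀ U, new189 D U → ∀ p ∈ plaqsOf (half D),
      Ineq195 (D.devV'' U p) (dist1 (plaqHol (D.Uhalf U (D.boxOf p)) p)) D.α ((D.L ^ D.h)⁻¹) (D.ε D.h) (E124 D.ε D.L D.η D.k D.h))
    (L91 : ∀ U, new189 D U → ∀ j, D.h ≤ j → j ≤ D.k → ∀ p ∈ plaqsOf (dom D j),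
      Ineq191 (dist1 (plaqHol (D.Upp U) p)) (D.dev97 U p) D.α ((D.L ^ j)⁻¹) (D.ε j) (E124 D.ε D.L D.η D.k j))
    (L97 : ∀ U, new189 D U → ∀ j, D.h ≤ j → j ≤ D.k → ∀ p ∈ plaqsOf (dom D j),
      Ineq191 (D.dev97 U p) (D.dev0 U p) D.α ((D.L ^ j)⁻¹) (D.ε j) (E124 D.ε D.L D.η D.k j))
    (L80 : ∀ U, new189 D U → ∀ j, D.h ≤ j → j ≤ D.k → ∀ p ∈ plaqsOf (dom D j),
      Ineq180 (D.dev0 U p) (D.ε D.k) D.η D.B₃ D.B₅ D.M D.δ (D.dist p) D.O1) :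
    Claim189 (new189 D) (chiPP D) :=
  claim189_sitOfHist₁₃_Λ_of_inInterval Nm P (((σ.pinSides θ.ν (gOfRecord₁₃ F N θ P) (k' - Nm) k').pinXΩ4 s₁₃ (enlD F θ.ν θ.τ9.M P (gOfRecord₁₃ F N θ P))).pinOmegaPP s₁₃ Nm (enlD F θ.ν θ.τ9.M P (gOfRecord₁₃ F N θ P))) s₁₃ p₁
    (pinSides_sh_pos σ θ.ν (gOfRecord₁₃ F N θ P) (k' - Nm) k' hM₂).1 hM hD hr hNN hNk hβ0 hβ hL₀ hL₀L hB hδ hwin hβhist hMl hA₀ S hβ₀ hε10 hI hup hΛ L91h L95 L91 L97 L80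

end Display

end B15Claim189ChiOmega4Pin

end Literature.MathematicalPhysics.QuantumFieldTheory.Balaban1983to89
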